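import Summits.Parity.GeneralizedHardyLittlewood.Theorems.LeeYangFibresAbsoluteUpgradeModGammaAdjointEqHalfPlane
import Literature.Analysis.Complex.HolomorphicParametricIntegral
import Literature.Analysis.Fourier.HolomorphicParamIntegral
import HarnessLib

/-!
# Route `LeeYangFibres`, crux `AbsoluteUpgrade` (stmt-Parity-14116), line `dip-margin-rate-exchange`:
# the adjoint method for `ModGammaDisc` — the adjoint equation on the disc (stub `mg_adjointEq`)

This file closes the registered stub `mg_adjointEq : MGEin → MGAdjointEq` of the line's vocabulary
`LeeYangFibresAbsoluteUpgradeModGammaDefs.lean`: for `N ≥ 1`, `|z| ≤ N - 1` and `v > 0`,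
`d/dv [v · adjTilde N z v] = -z · adjTilde N z (v + 1)`, by ANALYTIC CONTINUATION in `z` of the
half-plane case (helper #3, `mg_adjointEq_halfPlane`):

1. `AdjEq.differentiable_pCoeff` — the Taylor coefficients `p_k(z) = φ_z^{(k)}(0)/k!` are entire in `z`
   (Cauchy's formula `p_k(z) = (2πi)⁻¹∮_{|x|=1} φ_z(x)x^{-k-1}dx`, Mathlib
   `DifferentiableOn.circleIntegral_one_div_sub_center_pow_smul`, and holomorphic parametric integrals,
   tree `Literature.Analysis.Fourier.differentiableOn_integral_of_dominated_holomorphic`);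
2. `AdjEq.differentiableOn_integral_remZ` — the regularised Laplace integrals
   `∫_0^∞ x^m e^{-vx} x^{z+N} R_N(z,x) dx` are holomorphic on `U = {Re z > -N + 1/2}` (dominated holomorphic
   parametric integrals, tree `Literature.Analysis.Complex.differentiableOn_integral_of_dominated`, with
   the uniform kernel majorant of helper #1 on small balls);
3. hence both `F₁(z)` = the explicit derivative of Step 1 (helper #2, `mg_adjointEq_explicit`) and
   `F₂(z) = -z · adjTilde N z (v+1)` are holomorphic on the convex open half-plane `U ⊇ {|z| ≤ N-1}`; they
   agree near `z₀ = 1` by the half-plane equation and uniqueness of derivatives, so `F₁ = F₂` on `U`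
   (`AnalyticOnNhd.eqOn_of_preconnected_of_eventuallyEq`), and Step 1 gives `MGAdjointEq`.

References: G. Greaves, *Sieves in Number Theory* (2001), §4.2.3 [Greaves2001] (the real-variable
adjoint method); de Bruijn (1950), Alladi (1982), Tenenbaum III.6 for the Buchstab–Dickman context.
-/

noncomputable section

namespace Summit.Parity.GeneralizedHardyLittlewood.Cruxes.AbsoluteUpgrade.DipMarginRateExchange

open scoped BigOperators
open MeasureTheory Set Filter Topology
open Literature.NumberTheory.Sieve (ein einKernel)

namespace AdjEq

/-! ## Analyticity in `z` of the Taylor data and of the regularised integrals -/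

/-- Cauchy's formula for the Taylor coefficients: `p_k(z) = (2πi)⁻¹ ∮_{|x|=1} φ_z(x) x^{-k-1} dx`. -/
theorem pCoeff_eq_circleIntegral (hE : MGEin) (z : ℂ) (k : ℕ) :
    pCoeff z k = (2 * Real.pi * Complex.I)⁻¹ *
      ∮ x in C(0, 1), (1 / (x - 0) ^ (k + 1)) • phiZ z x := by
  have h := DifferentiableOn.circleIntegral_one_div_sub_center_pow_smul one_pos k
    ((differentiable_phiZ hE z).differentiableOn (s := Metric.closedBall (0:ℂ) 1))
  rw [h, pCoeff, smul_eq_mul]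
  have hk : (k.factorial : ℂ) ≠ 0 := by exact_mod_cast (Nat.factorial_pos k).ne'
  have hpi : (2 * Real.pi * Complex.I : ℂ) ≠ 0 := by simp [Real.pi_ne_zero, Complex.I_ne_zero]
  field_simp

/-- **The Taylor coefficients `p_k(z)` are entire functions of `z`** (holomorphic parametric circle
integral, `Literature.Analysis.Fourier.differentiableOn_integral_of_dominated_holomorphic`, with the
sup bound `exp((‖z₀‖+1) e)` on balls). -/
theorem differentiable_pCoeff (hE : MGEin) (k : ℕ) : Differentiable ℂ fun z => pCoeff z k := by
  set F : ℂ → ℝ → ℂ := fun z θ => deriv (circleMap 0 1) θ •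
    ((1 / (circleMap 0 1 θ - 0) ^ (k + 1)) • phiZ z (circleMap 0 1 θ)) with hF
  have hrepr : (fun z => pCoeff z k) = fun z => (2 * Real.pi * Complex.I)⁻¹ *
      ∫ θ in Ioc 0 (2 * Real.pi), F z θ := by
    funext z
    rw [pCoeff_eq_circleIntegral hE z k, circleIntegral, intervalIntegral.integral_of_le
      (by positivity : (0:ℝ) ≤ 2 * Real.pi)]
  rw [hrepr]
  refine Differentiable.const_mul (fun z₀ => ?_) _
  have hU : IsOpen (Metric.ball (0:ℂ) (‖z₀‖ + 1)) := Metric.isOpen_ball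
  have hmem : z₀ ∈ Metric.ball (0:ℂ) (‖z₀‖ + 1) := by simp
  have hne : ∀ θ : ℝ, circleMap 0 1 θ - 0 ≠ 0 := fun θ => by
    rw [sub_zero]; exact circleMap_ne_center one_ne_zero
  have hcontθ : ∀ z : ℂ, Continuous fun θ : ℝ => F z θ := by
    intro z
    have h1 : Continuous fun θ : ℝ => deriv (circleMap 0 1) θ := by
      simp only [deriv_circleMap]; fun_prop
    have h2 : Continuous fun θ : ℝ => (1 / (circleMap 0 1 θ - 0) ^ (k + 1)) :=
      continuous_const.div (((continuous_circleMap 0 1).sub continuous_const).pow _)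
        fun θ => pow_ne_zero _ (hne θ)
    have h3 : Continuous fun θ : ℝ => phiZ z (circleMap 0 1 θ) :=
      (continuous_phiZ hE z).comp (continuous_circleMap 0 1)
    exact h1.smul (h2.smul h3)
  refine (Literature.Analysis.Fourier.differentiableOn_integral_of_dominated_holomorphic hU
    (μ := volume.restrict (Ioc 0 (2 * Real.pi))) (K := F)
    (B := fun _ => Real.exp ((‖z₀‖ + 1) * Real.exp 1)) ?_ ?_ ?_ ?_).differentiableAt (hU.mem_nhds hmem)
  · exact fun z _ => (hcontθ z).aestronglyMeasurable
  · refine Eventually.of_forall fun θ => ?_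
    have : Differentiable ℂ fun z => F z θ := by
      simp only [hF, phiZ, smul_eq_mul]
      exact ((differentiable_id.mul (differentiable_const _)).neg.cexp.const_mul _).const_mul _
    exact this.differentiableOn
  · refine Eventually.of_forall fun θ z hz => ?_
    rw [Metric.mem_ball, dist_zero_right] at hz
    simp only [hF, norm_smul, deriv_circleMap, norm_mul, Complex.norm_I, norm_circleMap_zero,
      abs_one, mul_one, one_mul, norm_div, norm_one, norm_pow, sub_zero, one_pow, div_one]
    have h1 : ‖circleMap 0 1 θ‖ < 1 ∨ ‖circleMap 0 1 θ‖ = 1 := Or.inr (by simp)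
    calc ‖phiZ z (circleMap 0 1 θ)‖ ≤ Real.exp (‖z‖ * (‖circleMap 0 1 θ‖ * Real.exp ‖circleMap 0 1 θ‖)) :=
          norm_phiZ_le hE z _
      _ ≤ Real.exp ((‖z₀‖ + 1) * Real.exp 1) := by
          rw [Real.exp_le_exp, norm_circleMap_zero, abs_one, one_mul]
          exact mul_le_mul_of_nonneg_right hz.le (Real.exp_pos 1).le
  · exact integrable_const _

/-- `z ↦ R_N(z, x)` is entire. -/
theorem differentiable_remZ (hE : MGEin) (N : ℕ) (x : ℂ) :
    Differentiable ℂ fun z => remZ N z x := by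
  unfold remZ phiZ
  refine Differentiable.div_const (Differentiable.sub ?_ ?_) _
  · exact (differentiable_id.mul (differentiable_const _)).neg.cexp
  · exact Differentiable.fun_sum fun k _ => (differentiable_pCoeff hE k).mul_const _

/-- **Holomorphy in `z` of the regularised Laplace integrals** `∫_0^∞ x^m e^{-vx} x^{z+N} R_N(z,x) dx`
on the half-plane `Re z > -N + 1/2` (dominated holomorphic parametric integral,
`Literature.Analysis.Complex.differentiableOn_integral_of_dominated`, with the uniform majorant on
small balls). -/
theorem differentiableOn_integral_remZ (hE : MGEin) (N : ℕ) {v : ℝ} (hv : 0 < v) (m : ℕ) :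
    DifferentiableOn ℂ (fun z : ℂ => ∫ x in Ioi (0:ℝ), (x : ℂ) ^ m *
        (Complex.exp (-((v : ℂ) * x)) * ((x : ℂ) ^ (z + (N : ℂ))) * remZ N z x))
      {z : ℂ | -(N : ℝ) + 1 / 2 < z.re} := by
  set U : Set ℂ := {z : ℂ | -(N : ℝ) + 1 / 2 < z.re} with hU
  refine Literature.Analysis.Complex.differentiableOn_integral_of_dominated
    (μ := volume.restrict (Ioi (0:ℝ))) ?_ ?_ ?_
  · intro z _
    refine ContinuousOn.aestronglyMeasurable ?_ measurableSet_Ioi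
    refine (Continuous.continuousOn (by fun_prop)).mul ?_
    exact ((Continuous.continuousOn (by fun_prop)).mul (continuousOn_ofReal_cpow _)).mul
      (continuousOn_remZ_ofReal hE N z)
  · refine (ae_restrict_mem measurableSet_Ioi).mono fun x (hx : 0 < x) => ?_
    have hx0 : (x : ℂ) ≠ 0 := Complex.ofReal_ne_zero.mpr hx.ne'
    have h : Differentiable ℂ fun z : ℂ => (x : ℂ) ^ m *
        (Complex.exp (-((v : ℂ) * x)) * ((x : ℂ) ^ (z + (N : ℂ))) * remZ N z x) := by
      refine Differentiable.const_mul (Differentiable.mul (Differentiable.const_mul ?_ _)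
        (differentiable_remZ hE N x)) _
      exact (differentiable_id.add_const _).const_cpow (Or.inl hx0)
    exact h.differentiableOn
  · intro z₀ hz₀
    have hz₀' : -(N : ℝ) + 1 / 2 < z₀.re := hz₀
    set R : ℝ := min (1 / 4) ((z₀.re + N - 1 / 2) / 2) with hR
    have hR0 : 0 < R := lt_min (by norm_num) (by linarith)
    have hR4 : R ≤ 1 / 4 := min_le_left _ _
    have hR2 : R ≤ (z₀.re + N - 1 / 2) / 2 := min_le_right _ _
    have hball : ∀ z ∈ Metric.ball z₀ R, ‖z‖ ≤ ‖z₀‖ + 1 / 4 ∧ -(N : ℝ) + 1 / 2 < z.re := by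
      intro z hz
      rw [Metric.mem_ball, dist_eq_norm] at hz
      constructor
      · calc ‖z‖ = ‖z₀ + (z - z₀)‖ := by ring_nf
          _ ≤ ‖z₀‖ + ‖z - z₀‖ := norm_add_le _ _
          _ ≤ ‖z₀‖ + 1 / 4 := by linarith
      · have h1 : |(z - z₀).re| ≤ ‖z - z₀‖ := Complex.abs_re_le_norm _
        rw [Complex.sub_re] at h1
        have h2 := neg_abs_le (z.re - z₀.re)
        linarith
    refine ⟨R, hR0, fun z hz => (hball z hz).2, ?_⟩
    obtain ⟨C, hC0, hC⟩ := norm_cpow_mul_remZ_le hE N (Λ := ‖z₀‖ + 1 / 4) (σ := -(N:ℝ) + 1 / 2)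
      (by positivity) (by linarith)
    refine ⟨fun x => C * (x ^ ((m : ℝ) + (-(N:ℝ) + 1 / 2 + N)) * Real.exp (-(v * x)) +
        x ^ ((m : ℝ) + (2 * (‖z₀‖ + 1 / 4) + 2 * N)) * Real.exp (-(v * x))), ?_, ?_⟩
    · have ha : (-1:ℝ) < (m : ℝ) + (-(N:ℝ) + 1 / 2 + N) := by
        have := (Nat.cast_nonneg m : (0:ℝ) ≤ m); linarith
      have hb : (-1:ℝ) < (m : ℝ) + (2 * (‖z₀‖ + 1 / 4) + 2 * N) := by
        have := (Nat.cast_nonneg m : (0:ℝ) ≤ m); have := norm_nonneg z₀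
        have := (Nat.cast_nonneg N : (0:ℝ) ≤ N); linarith
      exact ((integrableOn_rpow_mul_exp_neg_mul ha hv).add
        (integrableOn_rpow_mul_exp_neg_mul hb hv)).const_mul C
    · refine (ae_restrict_mem measurableSet_Ioi).mono fun x (hx : 0 < x) z hz => ?_
      obtain ⟨hzΛ, hzσ⟩ := hball z hz
      have hK := hC z hzΛ hzσ.le x hx
      rw [norm_mul, mul_assoc (Complex.exp _), norm_mul, norm_cexp_neg_ofReal_mul, norm_pow,
        Complex.norm_real, Real.norm_of_nonneg hx.le]
      have hxm : (0:ℝ) ≤ x ^ m := pow_nonneg hx.le m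
      have he : (0:ℝ) ≤ Real.exp (-(v * x)) := (Real.exp_pos _).le
      have hma : x ^ ((m : ℝ) + (-(N:ℝ) + 1 / 2 + N)) = x ^ m * x ^ (-(N:ℝ) + 1 / 2 + N) := by
        rw [Real.rpow_add hx, Real.rpow_natCast]
      have hmb : x ^ ((m : ℝ) + (2 * (‖z₀‖ + 1 / 4) + 2 * N)) =
          x ^ m * x ^ (2 * (‖z₀‖ + 1 / 4) + 2 * N) := by
        rw [Real.rpow_add hx, Real.rpow_natCast]
      calc x ^ m * (Real.exp (-(v * x)) * ‖(x : ℂ) ^ (z + (N : ℂ)) * remZ N z x‖)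
          ≤ x ^ m * (Real.exp (-(v * x)) *
              (C * (x ^ (-(N:ℝ) + 1 / 2 + N) + x ^ (2 * (‖z₀‖ + 1 / 4) + 2 * N)))) := by
            gcongr
        _ = C * (x ^ ((m : ℝ) + (-(N:ℝ) + 1 / 2 + N)) * Real.exp (-(v * x)) +
              x ^ ((m : ℝ) + (2 * (‖z₀‖ + 1 / 4) + 2 * N)) * Real.exp (-(v * x))) := by
            rw [hma, hmb]; ring
/-! ## Analytic continuation to the disc -/

/-- `z ↦ (z+1)⋯(z+k)` is entire. -/
theorem differentiable_pochProd (k : ℕ) :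
    Differentiable ℂ fun z : ℂ => ∏ i ∈ Finset.range k, (z + ((i : ℂ) + 1)) :=
  fun _ => DifferentiableAt.fun_finsetProd fun _ _ => differentiableAt_id.add_const _

/-- `z ↦ 1/Γ(1+z)` is entire (`Complex.differentiable_one_div_Gamma`). -/
theorem differentiable_Gamma_inv_one_add :
    Differentiable ℂ fun z : ℂ => (Complex.Gamma (1 + z))⁻¹ :=
  Complex.differentiable_one_div_Gamma.comp (differentiable_id.const_add 1)

/-- The power-sum part `Σ_{k<N} p_k(z) (z+1)⋯(z+k) c_k(z) v^{-(z+k+1)}` is entire in `z` for entire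
coefficients `c_k`. -/
theorem differentiable_sum_part (hE : MGEin) (N : ℕ) {v : ℝ} (hv : 0 < v) (c : ℕ → ℂ → ℂ)
    (hc : ∀ k, Differentiable ℂ (c k)) :
    Differentiable ℂ fun z : ℂ => ∑ k ∈ Finset.range N, pCoeff z k *
      (∏ i ∈ Finset.range k, (z + ((i : ℂ) + 1))) * (c k z * (v : ℂ) ^ (-(z + ((k : ℂ) + 1)))) := by
  have hv0 : (v : ℂ) ≠ 0 := Complex.ofReal_ne_zero.mpr hv.ne'
  refine Differentiable.fun_sum fun k _ => ?_
  refine ((differentiable_pCoeff hE k).fun_mul (differentiable_pochProd k)).fun_mul ?_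
  refine (hc k).fun_mul ?_
  exact ((differentiable_id.add_const _).neg).const_cpow (Or.inl hv0)

/-- **`F₁`, the explicit derivative of Step 1, is holomorphic in `z` on `Re z > -N + 1/2`.** -/
theorem differentiableOn_explicitDeriv (hE : MGEin) (N : ℕ) {v : ℝ} (hv : 0 < v) :
    DifferentiableOn ℂ (fun z : ℂ => Complex.exp ((Real.eulerMascheroniConstant : ℂ) * z) *
        ((∑ k ∈ Finset.range N, pCoeff z k * (∏ i ∈ Finset.range k, (z + ((i : ℂ) + 1))) *
            (-(z + (k : ℂ)) * (v : ℂ) ^ (-(z + ((k : ℂ) + 1))))) +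
          (Complex.Gamma (1 + z))⁻¹ *
            ((∫ x in Ioi (0 : ℝ), Complex.exp (-((v : ℂ) * x)) * ((x : ℂ) ^ (z + (N : ℂ))) *
                remZ N z x) -
              (v : ℂ) * ∫ x in Ioi (0 : ℝ), (x : ℂ) *
                (Complex.exp (-((v : ℂ) * x)) * ((x : ℂ) ^ (z + (N : ℂ))) * remZ N z x))))
      {z : ℂ | -(N : ℝ) + 1 / 2 < z.re} := by
  have hI0 : DifferentiableOn ℂ (fun z : ℂ => ∫ x in Ioi (0 : ℝ), Complex.exp (-((v : ℂ) * x)) *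
      ((x : ℂ) ^ (z + (N : ℂ))) * remZ N z x) {z : ℂ | -(N : ℝ) + 1 / 2 < z.re} := by
    simpa only [pow_zero, one_mul] using differentiableOn_integral_remZ hE N hv 0
  have hI1 : DifferentiableOn ℂ (fun z : ℂ => ∫ x in Ioi (0 : ℝ), (x : ℂ) *
      (Complex.exp (-((v : ℂ) * x)) * ((x : ℂ) ^ (z + (N : ℂ))) * remZ N z x))
      {z : ℂ | -(N : ℝ) + 1 / 2 < z.re} := by
    simpa only [pow_one] using differentiableOn_integral_remZ hE N hv 1
  have hS := differentiable_sum_part hE N hv (fun k z => -(z + (k : ℂ))) fun k =>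
    (differentiable_id.add_const _).neg
  refine (Differentiable.differentiableOn (by fun_prop)).fun_mul ?_
  refine hS.differentiableOn.fun_add (differentiable_Gamma_inv_one_add.differentiableOn.fun_mul ?_)
  exact hI0.fun_sub (hI1.const_mul _)

/-- **`z ↦ adjTilde N z v` is holomorphic on the half-plane `Re z > -N + 1/2`** (`v > 0`): every
ingredient is — `e^{γz}`, the Taylor coefficients `p_k(z)`, `(z+1)⋯(z+k)`, `v^{-(z+k+1)}`,
`1/Γ(1+z)` and the regularised integral. -/
theorem differentiableOn_adjTilde (hE : MGEin) (N : ℕ) {v : ℝ} (hv : 0 < v) :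
    DifferentiableOn ℂ (fun z : ℂ => adjTilde N z v) {z : ℂ | -(N : ℝ) + 1 / 2 < z.re} := by
  have hI0 : DifferentiableOn ℂ (fun z : ℂ => ∫ x in Ioi (0 : ℝ), Complex.exp (-((v : ℂ) * x)) *
      ((x : ℂ) ^ (z + (N : ℂ))) * remZ N z x) {z : ℂ | -(N : ℝ) + 1 / 2 < z.re} := by
    simpa only [pow_zero, one_mul] using differentiableOn_integral_remZ hE N hv 0
  have hS := differentiable_sum_part hE N hv (fun _ _ => 1) fun _ => differentiable_const _
  simp only [one_mul] at hS
  unfold adjTilde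
  refine (Differentiable.differentiableOn (by fun_prop)).fun_mul ?_
  exact hS.differentiableOn.fun_add (differentiable_Gamma_inv_one_add.differentiableOn.fun_mul hI0)

/-- **`z ↦ -z · adjTilde N z v` is holomorphic on `Re z > -N + 1/2`.** -/
theorem differentiableOn_neg_mul_adjTilde (hE : MGEin) (N : ℕ) {v : ℝ} (hv : 0 < v) :
    DifferentiableOn ℂ (fun z : ℂ => -z * adjTilde N z v) {z : ℂ | -(N : ℝ) + 1 / 2 < z.re} := by
  refine (Differentiable.differentiableOn (by fun_prop)).fun_mul ?_
  exact differentiableOn_adjTilde hE N hv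

/-- **The explicit derivative equals `-z · adjTilde N z (v+1)` on the whole half-plane `Re z > -N +
1/2`** (identity theorem on the convex half-plane: both sides are holomorphic there and agree on `Re
z > 1/2`, where the half-plane adjoint equation and uniqueness of derivatives apply). -/
theorem explicitDeriv_eq (hE : MGEin) (N : ℕ) {v : ℝ} (hv : 0 < v) {z : ℂ}
    (hz : -(N : ℝ) + 1 / 2 < z.re) :
    Complex.exp ((Real.eulerMascheroniConstant : ℂ) * z) *
        ((∑ k ∈ Finset.range N, pCoeff z k * (∏ i ∈ Finset.range k, (z + ((i : ℂ) + 1))) *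
            (-(z + (k : ℂ)) * (v : ℂ) ^ (-(z + ((k : ℂ) + 1))))) +
          (Complex.Gamma (1 + z))⁻¹ *
            ((∫ x in Ioi (0 : ℝ), Complex.exp (-((v : ℂ) * x)) * ((x : ℂ) ^ (z + (N : ℂ))) *
                remZ N z x) -
              (v : ℂ) * ∫ x in Ioi (0 : ℝ), (x : ℂ) *
                (Complex.exp (-((v : ℂ) * x)) * ((x : ℂ) ^ (z + (N : ℂ))) * remZ N z x))) =
      -z * adjTilde N z (v + 1) := by
  set U : Set ℂ := {z : ℂ | -(N : ℝ) + 1 / 2 < z.re} with hU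
  have hUo : IsOpen U := isOpen_lt continuous_const Complex.continuous_re
  have hUc : IsPreconnected U := (convex_halfSpace_re_gt (-(N : ℝ) + 1 / 2)).isPreconnected
  have h1U : (1 : ℂ) ∈ U := by
    show -(N : ℝ) + 1 / 2 < (1 : ℂ).re
    have := (Nat.cast_nonneg N : (0:ℝ) ≤ N); simp; linarith
  have hF₁ := (differentiableOn_explicitDeriv hE N hv).analyticOnNhd hUo
  have hF₂ := (differentiableOn_neg_mul_adjTilde hE N (by linarith : 0 < v + 1)).analyticOnNhd hUo
  refine hF₁.eqOn_of_preconnected_of_eventuallyEq hF₂ hUc h1U ?_ hz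
  -- agreement near `z₀ = 1` (there `Re z > -1`)
  have hnhds : {z : ℂ | 1 / 2 < z.re} ∈ 𝓝 (1 : ℂ) :=
    (isOpen_lt continuous_const Complex.continuous_re).mem_nhds (by norm_num)
  filter_upwards [hnhds] with w (hw : 1 / 2 < w.re)
  have hw1 : -1 < w.re := by linarith
  have hwU : -(N : ℝ) + 1 / 2 ≤ w.re := by have := (Nat.cast_nonneg N : (0:ℝ) ≤ N); linarith
  exact (hasDerivAt_mul_adjTilde_explicit hE N hwU hv).unique
    (hasDerivAt_mul_adjTilde_of_re_gt hE N hw1 hv)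

end AdjEq

/-- **The adjoint equation on the disc** (registered stub `mg_adjointEq` of line
`dip-margin-rate-exchange`, crux stmt-Parity-14116): for `N ≥ 1`, `|z| ≤ N - 1` and `v > 0`, `d/dv
[v · adjTilde N z v] = -z · adjTilde N z (v + 1)` — the real-variable adjoint equation of the sieve
literature [Greaves2001, §4.2.3] for the `Γ`-normalised, regularised adjoint, continued analytically
in `z` from `Re z > -1` to the disc. -/
theorem mg_adjointEq : MGEin → MGAdjointEq := by
  intro hE N hN z hz v hv
  have hN1 : (1 : ℝ) ≤ N := by exact_mod_cast hN
  have hzU : -(N : ℝ) + 1 / 2 < z.re := by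
    have h1 := Complex.abs_re_le_norm z
    have h2 := neg_abs_le z.re
    linarith
  have h := AdjEq.hasDerivAt_mul_adjTilde_explicit hE N hzU.le hv
  rw [AdjEq.explicitDeriv_eq hE N hv hzU] at h
  exact h

end Summit.Parity.GeneralizedHardyLittlewood.Cruxes.AbsoluteUpgrade.DipMarginRateExchange

end
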